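import Summits.NavierStokesRegularity.NavierStokesRegularity.Theorems.ScenarioCensusRowF1Quenched
import Summits.NavierStokesRegularity.NavierStokesRegularity.Theorems.ScenarioCensusRowF1IntQuenchTop
import HarnessLib

/-!
# LINE 21 «quenched-top» port, part 2/3: §5 the joint compactness engine of weight 6 (`exists_eps_liouville₆`, `exists_eps_liouville_quench`); §6 the transfer — fast points,
# the sextic clock, the weight-6 joint transfer, analytic density (`joint_transfer₆`, `joint_transfer_everywhere₆`; `jointCond_everywhere₆` = the frozen-top port's `jointCond_everywhere₄`, BY NAME)

Re-homed for the scenario census (typer seat ns-census-typer-1 g9; the cells F1qnq / F1qn, the ancient rows A-ni / A-qnq and the floor IT are MEMBERS OF RECORD «DECIDED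
IN KERNEL IN FILES» of row F1 since census v1.77 (critic backstop idea-crit-7 PASS 02:53Z; ref ns-census-ref g10 PRE-CHECK ✓ §15.15 item 39; lead-presearch label);
this port makes them TREE-decided): VERBATIM PORT of the NEW declarations of ns-idea-3 LINE 21 «quenched-top»,
`pub/ideators/ns-idea-3/lines/quenched-top/line-quenched-top.lean` sha16 1fb0c3b1193b8625 (1967 l., lean check rc 0, 0 sorry; its §2–§4 and the frame of §1 are shared
VERBATIM with LINES 18/20/22/23 and taken BY NAME from the landed `ScenarioCensusRowF1IntQuench*` / `…Inviscid*` / `…Frozen*` / `…IntStretch*` ports — 101 declarations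
not re-declared), split for the 400-line rule into `ScenarioCensusRowF1Quenched` (§1) → `…QuenchedTransfer` (§5–§6) → `…QuenchedTop` (§7 + census KEYS).  Lean text
VERBATIM in namespace `…Theorems.ScenarioCensus.QuenchedTop` (the line's `…Cruxes.ScenarioCensusRowF1.QuenchedTopLine` re-homed) with `open …IntegratedQuench`; port edits:
`@[conjecture]` on the residual `QuenchSlack` (≡ `ScenarioCensus.Row_F1`, OPEN), one-line docstrings added where missing (gate lint); `vort_eq` is the frozen-top port's
`freeze_eq` and `norm_laplacian_curl_le` (used only inside the shared kill) is not re-declared.  Statements untouched.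

No census VALUE is moved here (row F1 stays OPEN-WITH-LINE; the members become TREE-decided by name); NS regularity is NOT proved; `Row_F1` is untouched (zero
movement, `quenchSlack_iff_rowF1`); no summit statement is proved by this file. Lemmas that restate already-landed tree declarations are taken BY NAME (gate lint `dedup.landed`): `vort_eq` = `FrozenTop.freeze_eq`, `jointCond_everywhere₆` = `FrozenTop.jointCond_everywhere₄`.
-/

-- the summit and its single problem share the name `NavierStokesRegularity` (D-0017 nested layout)
set_option linter.dupNamespace false

noncomputable section

open MeasureTheory Set Function Filter TopologicalSpace Metric
open scoped Topology NNReal ENNReal InnerProductSpace RealInnerProductSpace Laplacian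

namespace Summit.NavierStokesRegularity.NavierStokesRegularity.Theorems.ScenarioCensus.QuenchedTop

open Literature.Analysis Literature.Analysis.FluidPDE
open Summit.NavierStokesRegularity.NavierStokesRegularity.Theorems
open Summit.NavierStokesRegularity.NavierStokesRegularity.Theorems.ScenarioCensus.IntegratedQuench

/-! ## §5 The joint compactness engine of weight 6: exact Liouville ⇒ ε(M)-Liouville -/

/-- **COMPACTNESS UPGRADE, weight 6 (the engine).**  Let `R(v, L, H, K) ≥ 0` be a continuous read-out of (value,
gradient, Hessian, third-order datum), homogeneous of weight 6 under the `𝒦`-scaling `(v, L, H, K) ↦ (a v, a² L, a³ H, a⁴ K)`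
(so that `(−s)³ R(W, ∇W, ∇²W, Σᵢ D³W eᵢ eᵢ)(s, y)` is zoom-invariant).  If the EXACT Liouville theorem «`R ≡ 0 ⇒ W ≡ 0`»
holds in `𝒦_M`, then ONE `ε = ε(M, R) > 0` works: `(−s)³ R ≤ ε` everywhere ⇒ `W ≡ 0`.  Proof: normalise a bad sequence by
census row A2a (`θ = 1/2`) and the zoom, extract a `C³_loc` limit in `𝒦_M` (tree `C¹_loc` extraction + the Hessian and
third-order upgrades of §2): it is nontrivial with `R ≡ 0`. -/
theorem exists_eps_liouville₆ (M : ℝ) {R : E3 → (E3 →L[ℝ] E3) → Hess → (E3 →L[ℝ] E3) → ℝ}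
    (hRc : Continuous fun q : E3 × (E3 →L[ℝ] E3) × Hess × (E3 →L[ℝ] E3) => R q.1 q.2.1 q.2.2.1 q.2.2.2)
    (hR0 : ∀ v L H K, 0 ≤ R v L H K)
    (hRh : ∀ a : ℝ, 0 < a → ∀ v L H K, R (a • v) (a ^ 2 • L) (a ^ 3 • H) (a ^ 4 • K) = a ^ 6 * R v L H K)
    (hL : ∀ W : ℝ → E3 → E3, IsTypeIAncientMild M W →
      (∀ s < (0 : ℝ), ∀ y : E3,
        R (W s y) (fderiv ℝ (W s) y) (fderiv ℝ (fderiv ℝ (W s)) y) (lapD (W s) y) = 0) →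
      ∀ s < (0 : ℝ), ∀ y : E3, W s y = 0) :
    ∃ ε : ℝ, 0 < ε ∧ ∀ W : ℝ → E3 → E3, IsTypeIAncientMild M W →
      (∀ s < (0 : ℝ), ∀ y : E3,
        (-s) ^ 3 * R (W s y) (fderiv ℝ (W s) y) (fderiv ℝ (fderiv ℝ (W s)) y) (lapD (W s) y) ≤ ε) →
      ∀ s < (0 : ℝ), ∀ y : E3, W s y = 0 := by
  by_contra hcon
  have hseq : ∀ n : ℕ, ∃ W : ℝ → E3 → E3, IsTypeIAncientMild M W ∧
      (∀ s < (0 : ℝ), ∀ y : E3,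
        (-s) ^ 3 * R (W s y) (fderiv ℝ (W s) y) (fderiv ℝ (fderiv ℝ (W s)) y) (lapD (W s) y) ≤
          1 / ((n : ℝ) + 1)) ∧
      ∃ s < (0 : ℝ), ∃ y : E3, W s y ≠ 0 := by
    intro n
    by_contra h
    push Not at h
    exact hcon ⟨1 / ((n : ℝ) + 1), by positivity, h⟩
  choose W hW hD hnz using hseq
  -- ## (1) normalisation (census row A2a, `θ = 1/2`)
  have hbig : ∀ n, ∃ t < (0 : ℝ), ∃ x : E3, (1 / 2 : ℝ) / Real.sqrt (-t) < ‖W n t x‖ := by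
    intro n
    by_contra hc
    push Not at hc
    have hhalf : IsTypeIAncientMild (1 / 2) (W n) :=
      ⟨(hW n).1, (hW n).2.1, (hW n).2.2.1, fun t ht x => hc t ht x⟩
    obtain ⟨s, hs, y, hy⟩ := hnz n
    exact hy (ScenarioCensus.row_A2a_excluded (1 / 2) (by norm_num) (W n) hhalf s hs y)
  choose T hT X hX using hbig
  -- ## (2) zoom about `(T n, X n)` by `λ_n = √(-T n)`
  set lam : ℕ → ℝ := fun n => Real.sqrt (-T n) with hlam
  have hlam0 : ∀ n, 0 < lam n := fun n => Real.sqrt_pos.2 (neg_pos.2 (hT n))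
  have hlam2 : ∀ n, lam n ^ 2 = -T n := fun n => Real.sq_sqrt (neg_pos.2 (hT n)).le
  set v : ℕ → ℝ → E3 → E3 := fun n => lam n • stPull (lam n ^ 2) (lam n) 0 (X n) (W n) with hv
  have hvA : ∀ n, IsTypeIAncientMild M (v n) := fun n => isTypeIAncientMild_zoom (hW n) (hlam0 n) (X n)
  have hv_apply : ∀ n (s : ℝ) (y : E3), v n s y = lam n • W n (lam n ^ 2 * s) (X n + lam n • y) :=
    fun n s y => zoom_apply (lam n) (X n) (W n) s y
  have hv_fderiv : ∀ n, ∀ s < (0 : ℝ), ∀ y : E3,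
      fderiv ℝ (v n s) y = (lam n ^ 2) • fderiv ℝ (W n (lam n ^ 2 * s)) (X n + lam n • y) := by
    intro n s hs y
    have hs' : lam n ^ 2 * s < 0 := mul_neg_of_pos_of_neg (pow_pos (hlam0 n) 2) hs
    exact fderiv_zoom (X n) (W n) (((hW n).contDiff_slice hs').differentiable (by simp)) y
  have hv_hess : ∀ n (s : ℝ) (y : E3), fderiv ℝ (fderiv ℝ (v n s)) y =
      (lam n ^ 3) • fderiv ℝ (fderiv ℝ (W n (lam n ^ 2 * s))) (X n + lam n • y) :=
    fun n s y => InviscidTop.fderiv_fderiv_zoom (lam n) (X n) (W n) s y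
  have hv_lap : ∀ n (s : ℝ) (y : E3), lapD (v n s) y =
      (lam n ^ 4) • lapD (W n (lam n ^ 2 * s)) (X n + lam n • y) :=
    fun n s y => FrozenTop.lapD_zoom (lam n) (X n) (W n) s y
  have hv_big : ∀ n, (1 / 2 : ℝ) < ‖v n (-1) 0‖ := by
    intro n
    rw [hv_apply, smul_zero, add_zero, mul_neg_one, hlam2, neg_neg, norm_smul, Real.norm_eq_abs,
      abs_of_pos (hlam0 n)]
    have h := hX n
    rw [div_lt_iff₀ (hlam0 n)] at h
    linarith [mul_comm (lam n) ‖W n (T n) (X n)‖]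
  have hv_def : ∀ n, ∀ s < (0 : ℝ), ∀ y : E3,
      (-s) ^ 3 * R (v n s y) (fderiv ℝ (v n s) y) (fderiv ℝ (fderiv ℝ (v n s)) y) (lapD (v n s) y) ≤
        1 / ((n : ℝ) + 1) := by
    intro n s hs y
    have hs' : lam n ^ 2 * s < 0 := mul_neg_of_pos_of_neg (pow_pos (hlam0 n) 2) hs
    have key : ∀ Xr : ℝ, (-s) ^ 3 * (lam n ^ 6 * Xr) = (-(lam n ^ 2 * s)) ^ 3 * Xr := by
      intro Xr
      ring
    rw [hv_apply, hv_fderiv n s hs, hv_hess, hv_lap, hRh _ (hlam0 n), key]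
    exact hD n _ hs' _
  -- ## (3) the `C³_loc` extraction in `𝒦_M`
  obtain ⟨φ, hφ, U, hU, hconv, hgrad, -, -⟩ := exists_tendsto_of_isTypeIAncientMild_seq M hvA
  have hhess := InviscidTop.tendsto_fderiv_fderiv_of_isTypeIAncientMild_seq (v := fun j => v (φ j))
    (fun j => hvA (φ j)) hU hgrad
  have hlap := FrozenTop.tendsto_lapD_of_isTypeIAncientMild_seq (v := fun j => v (φ j))
    (fun j => hvA (φ j)) hU hgrad
  have hφt : Tendsto φ atTop atTop := hφ.tendsto_atTop
  have hDU : ∀ s < (0 : ℝ), ∀ y : E3,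
      R (U s y) (fderiv ℝ (U s) y) (fderiv ℝ (fderiv ℝ (U s)) y) (lapD (U s) y) = 0 := by
    intro s hs y
    have hj := (hconv s hs y).prodMk_nhds ((hgrad s hs y).prodMk_nhds
      ((hhess s hs y).prodMk_nhds (hlap s hs y)))
    have hlimD : Tendsto (fun j => (-s) ^ 3 *
        R (v (φ j) s y) (fderiv ℝ (v (φ j) s) y) (fderiv ℝ (fderiv ℝ (v (φ j) s)) y) (lapD (v (φ j) s) y))
        atTop (𝓝 ((-s) ^ 3 * R (U s y) (fderiv ℝ (U s) y) (fderiv ℝ (fderiv ℝ (U s)) y) (lapD (U s) y))) :=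
      ((hRc.tendsto _).comp hj).const_mul _
    have hzero : Tendsto (fun j => 1 / ((φ j : ℝ) + 1)) atTop (𝓝 0) :=
      tendsto_one_div_add_atTop_nhds_zero_nat.comp hφt
    have hle : (-s) ^ 3 * R (U s y) (fderiv ℝ (U s) y) (fderiv ℝ (fderiv ℝ (U s)) y) (lapD (U s) y) ≤ 0 :=
      le_of_tendsto_of_tendsto hlimD hzero (Eventually.of_forall fun j => hv_def (φ j) s hs y)
    have hw : 0 < (-s) ^ 3 := pow_pos (neg_pos.2 hs) 3
    have hn : R (U s y) (fderiv ℝ (U s) y) (fderiv ℝ (fderiv ℝ (U s)) y) (lapD (U s) y) ≤ 0 := by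
      by_contra hpos
      push Not at hpos
      exact absurd hle (not_le.2 (mul_pos hw hpos))
    exact le_antisymm hn (hR0 _ _ _ _)
  have hUbig : (1 / 2 : ℝ) ≤ ‖U (-1) 0‖ :=
    ge_of_tendsto ((hconv (-1) (by norm_num) 0).norm) (Eventually.of_forall fun j => (hv_big (φ j)).le)
  have hU0 : U (-1) 0 = 0 := hL U hU hDU (-1) (by norm_num) 0
  rw [hU0, norm_zero] at hUbig
  linarith

/-- **ε-LIOUVILLE, almost-non-intensifying vorticity** (new A-row, in kernel): ∀ M ∃ ε(M) > 0: `W ∈ 𝒦_M` with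
`(−s)³ ⟪ω, Δω + (ω·∇)W⟫ ≤ ε` everywhere (`ω = curl W`; one-sided) ⇒ `W ≡ 0`. -/
theorem exists_eps_liouville_quench (M : ℝ) : ∃ ε : ℝ, 0 < ε ∧ ∀ W : ℝ → E3 → E3,
    IsTypeIAncientMild M W →
    (∀ s < (0 : ℝ), ∀ y : E3, (-s) ^ 3 *
      ⟪curl (W s) y, (Δ (curl (W s))) y + convect (curl (W s)) (W s) y⟫ ≤ ε) →
    ∀ s < (0 : ℝ), ∀ y : E3, W s y = 0 := by
  obtain ⟨ε, hε, h⟩ := exists_eps_liouville₆ M (R := fun v L H K => max 0 (intensOf v L H K))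
    (continuous_const.max continuous_intensOf) (fun v L H K => le_max_left _ _) (fun a ha v L H K => by
      show max 0 (intensOf (a • v) (a ^ 2 • L) (a ^ 3 • H) (a ^ 4 • K)) = a ^ 6 * max 0 (intensOf v L H K)
      rw [intensOf_smul, mul_max_of_nonneg _ _ (pow_pos ha 6).le, mul_zero])
    (fun W hW h0 => eq_zero_of_nonIntensifying hW fun s hs y => by
      have h1 : max 0 (intensOf (W s y) (fderiv ℝ (W s) y) (fderiv ℝ (fderiv ℝ (W s)) y) (lapD (W s) y)) = 0 :=
        h0 s hs y
      rw [← intens_eq ((hW.contDiff_slice hs).of_le (by norm_cast))] at h1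
      exact max_eq_left_iff.1 h1)
  refine ⟨ε, hε, fun W hW hb s hs y => h W hW (fun s' hs' y' => ?_) s hs y⟩
  have h3 : ContDiff ℝ 3 (W s') := (hW.contDiff_slice hs').of_le (by norm_cast)
  show (-s') ^ 3 * max 0 (intensOf (W s' y') (fderiv ℝ (W s') y') (fderiv ℝ (fderiv ℝ (W s')) y') (lapD (W s') y')) ≤ ε
  rw [← intens_eq h3, mul_max_le_iff (pow_pos (neg_pos.2 hs') 3) hε.le]
  exact hb s' hs' y'

/-! ## §6 The transfer: fast points, the sextic clock, the weight-6 joint transfer, analytic density -/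

/-- **The sextic clock identity**: `(c R)⁶ (−t)³ = (ν (T − τ_j))³` under the `M`-normalisation (`R² = ν β`): the
weight-6 zoom weight `(−s)³` is exactly the pressure-free, viscosity-free physical weight `(T − t)³` (times `ν³` from
the `ν`-normalisation of the four arguments). -/
theorem sext_clock_eq {T ν t α β R : ℝ} (hν : 0 < ν) (hα : 0 < α) (hβ : 0 < β) (hαR : α * R = β)
    (hαν : α * Real.sqrt ν = Real.sqrt β) {c : ℕ → ℝ} (j : ℕ) :
    (c j * R) ^ 6 * (-t) ^ 3 = (ν * (T - (T + c j ^ 2 * β * t))) ^ 3 := by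
  have hR := FrozenTop.radius_eq hν hα hβ hαR hαν
  have hβ' : β = ν * α ^ 2 := by rw [← hαR, hR]; ring
  rw [hR, hβ']
  ring

/-- **JOINT TRANSFER, weight 6**: for a continuous read-out `Rd(v, L, H, K)`, homogeneous of weight 6 under
`(a, a², a³, a⁴)`, the physical bound «`(ν (T − t'))³ Rd(u/ν, ∇u/ν, ∇²u/ν, K/ν) ≤ ε` at the `Λ t'`-fast points,
eventually» passes to «`(−t)³ Rd(W, ∇W, ∇²W, Σᵢ D³W eᵢ eᵢ)(t, y) ≤ ε` at every `y` with `W(t, y) ≠ 0`». -/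
theorem joint_transfer₆ {T ν ε : ℝ} {u : ℝ → E3 → E3} {x₀ : E3} {α β R : ℝ} {c : ℕ → ℝ}
    {W : ℝ → E3 → E3} (hν : 0 < ν)
    (hα : 0 < α) (hβ : 0 < β) (hαR : α * R = β) (hαν : α * Real.sqrt ν = Real.sqrt β)
    (hcpos : ∀ j, 0 < c j) (hclim : Tendsto c atTop (𝓝 0))
    (hpt : ∀ t < 0, ∀ y : E3,
      Tendsto (fun j => (c j * α) • u (T + c j ^ 2 * β * t) (x₀ + (c j * R) • y)) atTop (𝓝 (W t y)))
    (hgrad : ∀ t < 0, ∀ y : E3,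
      Tendsto (fun j => (c j * α * (c j * R)) • fderiv ℝ (u (T + c j ^ 2 * β * t)) (x₀ + (c j * R) • y))
        atTop (𝓝 (fderiv ℝ (W t) y)))
    (hhess : ∀ t < 0, ∀ y : E3,
      Tendsto (fun j => (c j * α * (c j * R) * (c j * R)) •
          fderiv ℝ (fderiv ℝ (u (T + c j ^ 2 * β * t))) (x₀ + (c j * R) • y))
        atTop (𝓝 (fderiv ℝ (fderiv ℝ (W t)) y)))
    (hlap : ∀ t < 0, ∀ y : E3,
      Tendsto (fun j => (c j * α * (c j * R) * (c j * R) * (c j * R)) •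
          lapD (u (T + c j ^ 2 * β * t)) (x₀ + (c j * R) • y))
        atTop (𝓝 (lapD (W t) y)))
    {Rd : E3 → (E3 →L[ℝ] E3) → Hess → (E3 →L[ℝ] E3) → ℝ}
    (hRc : Continuous fun q : E3 × (E3 →L[ℝ] E3) × Hess × (E3 →L[ℝ] E3) => Rd q.1 q.2.1 q.2.2.1 q.2.2.2)
    (hRh : ∀ a : ℝ, 0 < a → ∀ v L H K, Rd (a • v) (a ^ 2 • L) (a ^ 3 • H) (a ^ 4 • K) = a ^ 6 * Rd v L H K)
    {Λ : ℝ → ℝ} (hΛ : IsSubcriticalLevel T Λ) (hH : HasJointDefect₆At T Λ ν ε Rd u) :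
    ∀ t < 0, ∀ y, W t y ≠ 0 →
      (-t) ^ 3 * Rd (W t y) (fderiv ℝ (W t) y) (fderiv ℝ (fderiv ℝ (W t)) y) (lapD (W t) y) ≤ ε := by
  intro t ht y hne
  have hj := (hpt t ht y).prodMk_nhds ((hgrad t ht y).prodMk_nhds ((hhess t ht y).prodMk_nhds (hlap t ht y)))
  have hlim := ((hRc.tendsto _).comp hj).const_mul ((-t) ^ 3)
  have hfast := ColumnarTop.eventually_fast hα hβ hcpos hclim hpt hΛ ht hne
  have hτ := ColumnarTop.tendsto_physicalTime (T := T) hβ ht hcpos hclim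
  have hR := FrozenTop.radius_eq hν hα hβ hαR hαν
  refine le_of_tendsto hlim ?_
  filter_upwards [hfast, hτ.eventually hH] with j hj1 hj2
  have hb := hj2 _ hj1
  have ha : 0 < c j * R := by rw [hR]; exact mul_pos (hcpos j) (mul_pos hν hα)
  -- the zoom quadruple is `(a • u/ν, a² • ∇u/ν, a³ • ∇²u/ν, a⁴ • K/ν)` with `a = c_j R`
  have e1 : c j * α = (c j * R) * ν⁻¹ := by rw [hR]; field_simp
  have e2 : c j * α * (c j * R) = (c j * R) ^ 2 * ν⁻¹ := by rw [hR]; field_simp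
  have e3 : c j * α * (c j * R) * (c j * R) = (c j * R) ^ 3 * ν⁻¹ := by rw [hR]; field_simp
  have e4 : c j * α * (c j * R) * (c j * R) * (c j * R) = (c j * R) ^ 4 * ν⁻¹ := by rw [hR]; field_simp
  show (-t) ^ 3 *
      Rd ((c j * α) • u (T + c j ^ 2 * β * t) (x₀ + (c j * R) • y))
        ((c j * α * (c j * R)) • fderiv ℝ (u (T + c j ^ 2 * β * t)) (x₀ + (c j * R) • y))
        ((c j * α * (c j * R) * (c j * R)) •
          fderiv ℝ (fderiv ℝ (u (T + c j ^ 2 * β * t))) (x₀ + (c j * R) • y))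
        ((c j * α * (c j * R) * (c j * R) * (c j * R)) •
          lapD (u (T + c j ^ 2 * β * t)) (x₀ + (c j * R) • y)) ≤ ε
  rw [e4, e3, e2, e1, mul_smul (c j * R) ν⁻¹, mul_smul ((c j * R) ^ 2) ν⁻¹, mul_smul ((c j * R) ^ 3) ν⁻¹,
    mul_smul ((c j * R) ^ 4) ν⁻¹, hRh _ ha, ← mul_assoc, mul_comm ((-t) ^ 3),
    sext_clock_eq (T := T) (t := t) hν hα hβ hαR hαν j]
  exact hb

-- `jointCond_everywhere₆`: the line restates the tree's `FrozenTop.jointCond_everywhere₄`; taken BY NAME (gate lint dedup.landed).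

/-- **The full joint transfer (weight 6)**: an ε-joint-defect of a nonnegative, weight-6 homogeneous, continuous
read-out on the top passes to `(−s)³ Rd(W, ∇W, ∇²W, Σᵢ D³W eᵢ eᵢ)(s, y) ≤ ε` at EVERY point of the open past of the limit. -/
theorem joint_transfer_everywhere₆ {T ν ε M : ℝ} {u : ℝ → E3 → E3} {x₀ : E3} {α β R : ℝ} {c : ℕ → ℝ}
    {W : ℝ → E3 → E3} (hW : IsTypeIAncientMild M W) (hν : 0 < ν)
    (hα : 0 < α) (hβ : 0 < β) (hαR : α * R = β) (hαν : α * Real.sqrt ν = Real.sqrt β)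
    (hcpos : ∀ j, 0 < c j) (hclim : Tendsto c atTop (𝓝 0))
    (hpt : ∀ t < 0, ∀ y : E3,
      Tendsto (fun j => (c j * α) • u (T + c j ^ 2 * β * t) (x₀ + (c j * R) • y)) atTop (𝓝 (W t y)))
    (hgrad : ∀ t < 0, ∀ y : E3,
      Tendsto (fun j => (c j * α * (c j * R)) • fderiv ℝ (u (T + c j ^ 2 * β * t)) (x₀ + (c j * R) • y))
        atTop (𝓝 (fderiv ℝ (W t) y)))
    (hhess : ∀ t < 0, ∀ y : E3,
      Tendsto (fun j => (c j * α * (c j * R) * (c j * R)) •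
          fderiv ℝ (fderiv ℝ (u (T + c j ^ 2 * β * t))) (x₀ + (c j * R) • y))
        atTop (𝓝 (fderiv ℝ (fderiv ℝ (W t)) y)))
    (hlap : ∀ t < 0, ∀ y : E3,
      Tendsto (fun j => (c j * α * (c j * R) * (c j * R) * (c j * R)) •
          lapD (u (T + c j ^ 2 * β * t)) (x₀ + (c j * R) • y))
        atTop (𝓝 (lapD (W t) y)))
    {Rd : E3 → (E3 →L[ℝ] E3) → Hess → (E3 →L[ℝ] E3) → ℝ}
    (hRc : Continuous fun q : E3 × (E3 →L[ℝ] E3) × Hess × (E3 →L[ℝ] E3) => Rd q.1 q.2.1 q.2.2.1 q.2.2.2)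
    (hRh : ∀ a : ℝ, 0 < a → ∀ v L H K, Rd (a • v) (a ^ 2 • L) (a ^ 3 • H) (a ^ 4 • K) = a ^ 6 * Rd v L H K)
    (hR0 : Rd 0 0 0 0 = 0) (hε : 0 ≤ ε) {Λ : ℝ → ℝ} (hΛ : IsSubcriticalLevel T Λ)
    (hH : HasJointDefect₆At T Λ ν ε Rd u) :
    ∀ s < 0, ∀ y,
      (-s) ^ 3 * Rd (W s y) (fderiv ℝ (W s) y) (fderiv ℝ (fderiv ℝ (W s)) y) (lapD (W s) y) ≤ ε := by
  have hPc : ∀ w : ℝ,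
      IsClosed {q : E3 × (E3 →L[ℝ] E3) × Hess × (E3 →L[ℝ] E3) | (-w) ^ 3 * Rd q.1 q.2.1 q.2.2.1 q.2.2.2 ≤ ε} :=
    fun w => isClosed_le (continuous_const.mul hRc) continuous_const
  exact FrozenTop.jointCond_everywhere₄ hW (P := fun w q => (-w) ^ 3 * Rd q.1 q.2.1 q.2.2.1 q.2.2.2 ≤ ε) hPc
    (fun w => by show (-w) ^ 3 * Rd 0 0 0 0 ≤ ε; rw [hR0, mul_zero]; exact hε)
    (joint_transfer₆ hν hα hβ hαR hαν hcpos hclim hpt hgrad hhess hlap hRc hRh hΛ hH)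

end Summit.NavierStokesRegularity.NavierStokesRegularity.Theorems.ScenarioCensus.QuenchedTop

end
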